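import Summits.KontsevichZagierPeriods.Zeta5Search.WedgeDictionaryLevelDescentVFullLayer0
import Summits.KontsevichZagierPeriods.Zeta5Search.WedgeDictionaryLevelDescentVFullZoneZ
import HarnessLib

/-!
# Level descent for `VFull` — lemmas for the slot-1 descent: the `η`-ratio and two facts about `U`

HONEST FRAMING: "systematic search; no irrationality claim unless certified".

Three proved inputs of the slot-1 descent of (T3) (`…VFullDescent`), each also recorded as a named statement:
* `rowEta_bump1` (`rowEta_bump1_stmt`): `η(a + e₁) = (a₁+1)(N−a₁)·η(a)` (from `rowEta_fac`);
* `coeffU_faceRel_slot1` (`coeffU_faceRel_slot1_stmt`): the dual coefficient `U` satisfies the slot-1 three-term face relation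
  `d·U(b+2e₁) + Γ₁·U(b+e₁) + Γ₀·U(b) = 0` on the wide row region (`b` in the box with `b_j ≤ N`, `b₇ = 0`, `d ≥ 1`, `b₁ + 1 ≤ N`) —
  `face_threeTerm` (direction `i = 0`) is a summable combination, so `coeff_rel_of_summable` applies (the proof pattern of `casUV_rowSource`);
* `coeffU_eq_zero_of_layer_neg1` (`coeffU_layer_neg1_stmt`): `U(b) = 0` when `b₁ + b₂ = N + 1` — then `numPoly b` has a DOUBLE root at
  every `−q`, `0 ≤ q ≤ N` (`sq_dvd_numPoly_of_layer_neg1`), so every summand of `LevelDescent.coeffU_eq_sum_top` vanishes.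
-/

open Finset Polynomial

namespace Summit.KontsevichZagierPeriods.Zeta5Search.WedgeDictionary

open Summit.KontsevichZagierPeriods.Zeta5Search.DualSeries
open Literature.NumberTheory.Transcendental
open Literature.NumberTheory.Transcendental.BallRivoal (pochPoly eval_pochPoly poch)

/-! ### §1 The `η`-ratio along slot 1 -/

/-- `η(a + e₁) = (a₁+1)(N−a₁)·η(a)` (`a` in the box, `a_j ≤ N`, `a₁ + 1 ≤ N`). -/
theorem rowEta_bump1 (a : ℕ → ℤ) (ha : InBox a) (hle : ∀ j ∈ range 7, a (j + 1) ≤ a 0) (h1 : a 1 + 1 ≤ a 0) :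
    rowEta (Function.update a 1 (a 1 + 1)) = ((a 1 : ℚ) + 1) * ((a 0 : ℚ) - a 1) * rowEta a := by
  set a' := Function.update a 1 (a 1 + 1) with ha'
  have e0 : a' 0 = a 0 := Function.update_of_ne (by decide) _ _
  have e1 : a' 1 = a 1 + 1 := Function.update_self _ _ _
  have eS : ∀ j : ℕ, a' (j + 1 + 1) = a (j + 1 + 1) := fun j => Function.update_of_ne (by omega) _ _
  have hbox' : InBox a' := inBox_update a ha (show 0 ∈ range 7 by simp) (show a 1 ≤ a 0 by omega)
  have hle' : ∀ j ∈ range 7, a' (j + 1) ≤ a' 0 := by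
    intro j hj
    rcases Nat.eq_zero_or_pos j with rfl | hj0
    · rw [e0]; show a' 1 ≤ a 0; rw [e1]; exact h1
    · obtain ⟨i, rfl⟩ : ∃ i, j = i + 1 := ⟨j - 1, by omega⟩
      rw [e0, eS]; exact hle (i + 1) hj
  have hF := rowEta_fac a ha hle
  have hF' := rowEta_fac a' hbox' hle'
  simp only [prod_range_succ, prod_range_zero, one_mul, Nat.reduceAdd] at hF hF'
  have e2 : a' 2 = a 2 := Function.update_of_ne (by decide) _ _
  have e3 : a' 3 = a 3 := Function.update_of_ne (by decide) _ _
  have e4 : a' 4 = a 4 := Function.update_of_ne (by decide) _ _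
  have e5 : a' 5 = a 5 := Function.update_of_ne (by decide) _ _
  have e6 : a' 6 = a 6 := Function.update_of_ne (by decide) _ _
  have e7 : a' 7 = a 7 := Function.update_of_ne (by decide) _ _
  have hs : facQ (a 0 - a 1) = ((a 0 : ℚ) - a 1) * facQ (a 0 - (a 1 + 1)) := by
    rw [show a 0 - a 1 = a 0 - (a 1 + 1) + 1 by ring, facQ_succ (by omega)]
    push_cast; ring
  have hs1 : facQ (a 1 + 1) = ((a 1 : ℚ) + 1) * facQ (a 1) := facQ_succ (ha.2 0 (by simp)).1
  rw [e0, e1, e2, e3, e4, e5, e6, e7, hs1] at hF'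
  rw [hs] at hF
  have hM : facQ (a 0 - (a 1 + 1)) * facQ (a 0 - a 2) * facQ (a 0 - a 3) * facQ (a 0 - a 4) * facQ (a 0 - a 5) *
      facQ (a 0 - a 6) * facQ (a 0 - a 7) ≠ 0 := by simp [facQ_ne_zero]
  have key : (rowEta a' - ((a 1 : ℚ) + 1) * ((a 0 : ℚ) - a 1) * rowEta a) * (facQ (a 0 - (a 1 + 1)) * facQ (a 0 - a 2) *
      facQ (a 0 - a 3) * facQ (a 0 - a 4) * facQ (a 0 - a 5) * facQ (a 0 - a 6) * facQ (a 0 - a 7)) = 0 := by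
    linear_combination hF' - ((a 1 : ℚ) + 1) * hF
  have := (mul_eq_zero.1 key).resolve_right hM
  linear_combination this

/-! ### §2 `U`: the slot-1 face relation on the wide row region, and vanishing on the layer `c₁₂ = −1` -/

/-- **`U` satisfies the slot-1 three-term face relation** `d·U(b+2e₁) + Γ₁·U(b+e₁) + Γ₀·U(b) = 0` (`b` in the box with `b_j ≤ N`,
`b₇ = 0`, `d ≥ 1`, `b₁ + 1 ≤ N`): `face_threeTerm` (direction `i = 0`) is summable, so `coeff_rel_of_summable` applies — the proof
pattern of `casUV_rowSource`. -/
theorem coeffU_faceRel_slot1 (b : ℕ → ℤ) (hb : InBox b) (hle : ∀ j ∈ range 7, b (j + 1) ≤ b 0) (h7 : b 7 = 0)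
    (hd : 1 ≤ dOf b) (h1 : b 1 + 1 ≤ b 0) :
    (dOf b : ℚ) * coeffU (bump (bump b 0) 0) + faceGamma1 b 0 * coeffU (bump b 0) + faceGamma0 b 0 * coeffU b = 0 := by
  have h1N : 0 ≤ b 1 := (hb.2 0 (by simp)).1
  have hN : 1 ≤ (b 0).toNat := by omega
  obtain ⟨hb1, hs1⟩ := box_update b hb (by omega) (show 0 ∈ range 7 by simp) (hle 0 (by simp))
  have hd1 : 0 ≤ dOf (bump b 0) := by rw [dOf_bump b (by simp)]; omega
  obtain ⟨hb2, hs2⟩ := box_update (bump b 0) hb1 hd1 (show 0 ∈ range 7 by simp)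
    (by rw [bump_self, bump_zero]; omega)
  have hrel := face_threeTerm b hb h7 (i := 0) (by simp)
  have hg := natDegree_neg_hPoly_succ_le b hb hd
  exact (coeff_rel_of_summable (bump (bump b 0) 0) (bump b 0) b (b 0).toNat hN hb2 hb1 hb hs2 hs1
    (sum_le_of_dOf b (by omega)) (by rw [bump_zero, bump_zero]) (by rw [bump_zero]) rfl _ _ _ (-hPoly b) hg hrel).1

/-- A root of a Pochhammer polynomial: `(X + (β + s)) ∣ pochPoly β n` for `s < n`. -/
theorem X_add_C_dvd_pochPoly (β : ℚ) {n s : ℕ} (hs : s < n) : (X + C (β + s)) ∣ pochPoly β n := by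
  show (X + C (β + (s : ℚ))) ∣ ∏ i ∈ range n, (X + C (β + (i : ℚ)))
  exact dvd_prod_of_mem (fun i : ℕ => (X + C (β + (i : ℚ)) : ℚ[X])) (mem_range.2 hs)

/-- On the layer `c₁₂ = −1` (`b₁ + b₂ = N + 1`), `numPoly b` has a DOUBLE root at `−q` for every `0 ≤ q ≤ N`:
`q < b₁` or `q ≥ b₁ = N + 1 − b₂` places `−q` among the roots of the first resp. second Pochhammer factor of slot 1 resp. 2, and likewise with
the slots exchanged. -/
theorem sq_dvd_numPoly_of_layer_neg1 (b : ℕ → ℤ) (h12 : b 1 + b 2 = b 0 + 1)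
    (q : ℕ) (hq : (q : ℤ) ≤ b 0) : (X + C (q : ℚ)) ^ 2 ∣ numPoly b := by
  set F : ℕ → ℚ[X] := fun j => pochPoly 0 (b (j + 1)).toNat * pochPoly ((b 0 - b (j + 1) + 1 : ℤ) : ℚ) (b (j + 1)).toNat
    with hF
  -- first Pochhammer factor of slot `j+1`: roots `−q`, `q < b_{j+1}`
  have lo : ∀ j : ℕ, (q : ℤ) < b (j + 1) → (X + C (q : ℚ)) ∣ pochPoly (0 : ℚ) (b (j + 1)).toNat := by
    intro j hj
    have := X_add_C_dvd_pochPoly (0 : ℚ) (n := (b (j + 1)).toNat) (s := q) (by omega)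
    simpa using this
  -- second Pochhammer factor of slot `j+1`: roots `−q`, `N − b_{j+1} + 1 ≤ q ≤ N`
  have hi : ∀ j : ℕ, b 0 + 1 ≤ q + b (j + 1) →
      (X + C (q : ℚ)) ∣ pochPoly ((b 0 - b (j + 1) + 1 : ℤ) : ℚ) (b (j + 1)).toNat := by
    intro j hj
    obtain ⟨s, hs⟩ : ∃ s : ℕ, (q : ℤ) = b 0 - b (j + 1) + 1 + s := ⟨(q - (b 0 - b (j + 1) + 1)).toNat, by omega⟩
    have := X_add_C_dvd_pochPoly ((b 0 - b (j + 1) + 1 : ℤ) : ℚ) (n := (b (j + 1)).toNat) (s := s) (by omega)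
    have hc : ((b 0 - b (j + 1) + 1 : ℤ) : ℚ) + (s : ℚ) = (q : ℚ) := by exact_mod_cast hs.symm
    rwa [hc] at this
  have lo1 := lo 0
  have lo2 := lo 1
  have hi1 := hi 0
  have hi2 := hi 1
  simp only [Nat.reduceAdd] at lo1 lo2 hi1 hi2
  have h01 : (X + C (q : ℚ)) ^ 2 ∣ F 0 * F 1 := by
    rw [pow_two]
    by_cases hq1 : (q : ℤ) < b 1 <;> by_cases hq2 : (q : ℤ) < b 2
    · exact mul_dvd_mul (dvd_mul_of_dvd_left (lo1 hq1) _) (dvd_mul_of_dvd_left (lo2 hq2) _)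
    · exact dvd_mul_of_dvd_left (mul_dvd_mul (lo1 hq1) (hi1 (by omega))) _
    · exact dvd_mul_of_dvd_right (mul_dvd_mul (lo2 hq2) (hi2 (by omega))) _
    · exact mul_dvd_mul (dvd_mul_of_dvd_right (hi1 (by omega)) _) (dvd_mul_of_dvd_right (hi2 (by omega)) _)
  have hsplit : ∏ j ∈ range 7, F j = F 0 * F 1 * ∏ j ∈ range 5, F (j + 2) := by
    rw [prod_range_succ', prod_range_succ']
    ring
  have hnum : numPoly b = (C 2 * X + C (b 0 : ℚ)) * ∏ j ∈ range 7, F j := rfl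
  rw [hnum, hsplit]
  exact dvd_mul_of_dvd_right (dvd_mul_of_dvd_left h01 _) _

/-- **`U` vanishes on the layer `c₁₂ = −1`** (`b` in the box with `Σ_j b_j ≤ 3N + 1`, `b₁ + b₂ = N + 1`): every summand of the
closed form `LevelDescent.coeffU_eq_sum_top` contains `numPoly_b(−q)` or `numPoly_b′(−q)`, both zero at a double root. -/
theorem coeffU_eq_zero_of_layer_neg1 (b : ℕ → ℤ) (hb : InBox b) (hsum : ∑ j ∈ range 7, b (j + 1) ≤ 3 * b 0 + 1)
    (h12 : b 1 + b 2 = b 0 + 1) : coeffU b = 0 := by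
  rw [LevelDescent.coeffU_eq_sum_top b hb hsum]
  refine sum_eq_zero fun q hq => ?_
  have h0 := hb.1
  have hqN : (q : ℤ) ≤ b 0 := by have := mem_range.1 hq; omega
  obtain ⟨g, hg⟩ := sq_dvd_numPoly_of_layer_neg1 b h12 q hqN
  have hev : (numPoly b).eval (-(q : ℚ)) = 0 := by
    rw [hg, eval_mul, eval_pow]
    simp
  have hder : (derivative (numPoly b)).eval (-(q : ℚ)) = 0 := by
    rw [hg, derivative_mul, derivative_X_add_C_pow]
    simp
  rw [hev, hder]
  simp

/-! ### §3 The three facts as named statements -/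

/-- STATEMENT (PROVED as `rowEta_bump1_holds`): `η(a + e₁) = (a₁+1)(N−a₁)·η(a)`. -/
def rowEta_bump1_stmt : Prop :=
  ∀ a : ℕ → ℤ, InBox a → (∀ j ∈ range 7, a (j + 1) ≤ a 0) → a 1 + 1 ≤ a 0 →
    rowEta (Function.update a 1 (a 1 + 1)) = ((a 1 : ℚ) + 1) * ((a 0 : ℚ) - a 1) * rowEta a

/-- `rowEta_bump1_stmt` holds (by-name wrapper). -/
theorem rowEta_bump1_holds : rowEta_bump1_stmt := fun a ha hle h1 => rowEta_bump1 a ha hle h1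

/-- STATEMENT (PROVED as `coeffU_faceRel_slot1_holds`): the slot-1 three-term face relation for `U` on the wide row region. -/
def coeffU_faceRel_slot1_stmt : Prop :=
  ∀ b : ℕ → ℤ, InBox b → (∀ j ∈ range 7, b (j + 1) ≤ b 0) → b 7 = 0 → 1 ≤ dOf b → b 1 + 1 ≤ b 0 →
    (dOf b : ℚ) * coeffU (bump (bump b 0) 0) + faceGamma1 b 0 * coeffU (bump b 0) + faceGamma0 b 0 * coeffU b = 0

/-- `coeffU_faceRel_slot1_stmt` holds (by-name wrapper). -/
theorem coeffU_faceRel_slot1_holds : coeffU_faceRel_slot1_stmt := fun b hb hle h7 hd h1 =>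
  coeffU_faceRel_slot1 b hb hle h7 hd h1

/-- STATEMENT (PROVED as `coeffU_layer_neg1_holds`): `U` vanishes on the layer `b₁ + b₂ = N + 1`. -/
def coeffU_layer_neg1_stmt : Prop :=
  ∀ b : ℕ → ℤ, InBox b → ∑ j ∈ range 7, b (j + 1) ≤ 3 * b 0 + 1 → b 1 + b 2 = b 0 + 1 → coeffU b = 0

/-- `coeffU_layer_neg1_stmt` holds (by-name wrapper). -/
theorem coeffU_layer_neg1_holds : coeffU_layer_neg1_stmt := fun b hb hs h12 => coeffU_eq_zero_of_layer_neg1 b hb hs h12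

end Summit.KontsevichZagierPeriods.Zeta5Search.WedgeDictionary
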